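import Mathlib
import Literature.AlgebraicGeometry.Resolution.RegularSystemOfParameters
import Literature.AlgebraicGeometry.Resolution.RsopMonomialIdeals
import Literature.AlgebraicGeometry.Resolution.StrictNormalCrossingsAt

/-!
# Crux `Steer` (stmt-ResolutionOfSingularities-16345), σ-residual LOW half at `p = 2`:
# quadratic detectors in a regular local ring (support for tri-2's one-step lemma `lowOrder_step_two`)

OURS (campaign `res-hironaka`, rung L ★L-G4, slot W4.1, chain W4.1; seat `res-D-pv-028` g6 on res-L0-w41-plan-1
RULING 15 (15b) «res-D-pv-028: TAKE `lowOrder_step_two`»; replaces the role of no printed item; NOT a statement of the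
manuscript under review [claim: Hironaka2017, status: under-review]; AI review is weaker than expert review).
Pure local algebra, no valuation, no blow-up:

* §1 `cross_term_not_mem_pow_three` — **the cross-term detector**: in a regular local ring of characteristic `2`
  with regular system of parameters `z`, an element `c² + z i₁ · z i₂ + Σ_{l ∈ L} z l · a l` with `c, a l ∈ 𝔪`,
  `i₁ ≠ i₂` and `i₁, i₂ ∉ L` is NOT in `𝔪³` (quasi-regularity, Matsumura Thm. 17.10: the coefficient of
  `Z_{i₁} Z_{i₂}` in the degree-2 form is `1 ∉ 𝔪`);
* §2 `mem_maximalIdeal_of_sum_mul_mem_sq` — `Σ_{l ∈ L} z l · a l ∈ 𝔪² ⇒ a l ∈ 𝔪` (degree-1 quasi-regularity);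
* §3 `smul_of_two_relations_mod_span` — linear algebra: if `h + r` vectors `w, u` span a space of dimension
  `h + r - 1`... stated as: `h` vectors `w` and a subspace `U` with `span (w ∪ U) = ⊤`, `finrank = h + finrank U - 1`,
  and a relation `Σ c j • w j ∈ U` with `c ≠ 0`: every relation `Σ e j • w j ∈ U` has `e = t • c`;
* §4 `exists_rsop_extending` — lifts of linearly independent cotangent classes are the first members of a regular
  system of parameters (`exists_extend_to_rsop` + `IsRsopPart.exists_rsop`).
[cite: Matsumura1987, Thm. 17.10] [folklore]
-/

-- The namespace mirrors the chain's helper layout (`…Theorems.SwitchingDichotomy.<Piece>`) on purpose.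
set_option linter.dupNamespace false

noncomputable section

namespace Summit.ResolutionOfSingularities.ResolutionOfSingularities.Theorems.SwitchingDichotomy.LowOrderDetector

open IsLocalRing Module MvPolynomial Literature.AlgebraicGeometry.Resolution

universe u

section Detector

variable {R : Type u} [CommRing R] [IsRegularLocalRing R] {d : ℕ}
  (hd : (maximalIdeal R).spanFinrank = d) (z : Fin d → R) (hz : Ideal.span (Set.range z) = maximalIdeal R)
include hd hz

/-! ## §2 Degree one: coefficients of a combination of regular parameters lying in `𝔪²` -/

/-- **Degree-one quasi-regularity**: if `Σ_{l ∈ L} z l · a l ∈ 𝔪²` for a regular system of parameters `z`, then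
`a l ∈ 𝔪` for every `l ∈ L`. [cite: Matsumura1987, Thm. 17.10] -/
theorem mem_maximalIdeal_of_sum_mul_mem_sq (L : Finset (Fin d)) (a : Fin d → R)
    (h : ∑ l ∈ L, z l * a l ∈ maximalIdeal R ^ 2) : ∀ l ∈ L, a l ∈ maximalIdeal R := by
  classical
  intro l hl
  -- the degree-one form `Σ_{l ∈ L} a l · X l`
  set G : MvPolynomial (Fin d) R := ∑ l ∈ L, monomial (Finsupp.single l 1) (a l) with hG
  have hGhom : G.IsHomogeneous 1 := by
    refine IsHomogeneous.sum _ _ _ fun l _ => isHomogeneous_monomial _ ?_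
    rw [Finsupp.degree_single]
  have hGeval : eval z G = ∑ l ∈ L, z l * a l := by
    rw [hG, map_sum]
    refine Finset.sum_congr rfl fun l _ => ?_
    rw [eval_monomial, Finsupp.prod_single_index (by simp), pow_one, mul_comm]
  have hcoeff := coeff_mem_maximalIdeal_of_eval_mem_pow hd z hz hGhom (by rw [hGeval]; exact h)
    (Finsupp.single l 1)
  have : G.coeff (Finsupp.single l 1) = a l := by
    rw [hG, coeff_sum, Finset.sum_eq_single l]
    · rw [coeff_monomial, if_pos rfl]
    · intro l' _ hl'
      rw [coeff_monomial, if_neg]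
      intro heq
      exact hl' (Finsupp.single_left_injective one_ne_zero heq)
    · intro hl'; exact absurd hl hl'
  rw [this] at hcoeff
  exact hcoeff

/-! ## §1 Degree two: the cross-term detector -/

/-- **The cross-term detector** (characteristic `2`): for a regular system of parameters `z`, indices `i₁ ≠ i₂`
outside `L`, and `c, a l ∈ 𝔪` (`l ∈ L`), the element `c ^ 2 + z i₁ * z i₂ + Σ_{l ∈ L} z l * a l` does NOT lie in
`𝔪 ^ 3`: written as a degree-2 form in `z` (squares contribute only to the diagonal in characteristic `2`, the
last sum only to monomials divisible by some `Z_l`, `l ∈ L`), its `Z_{i₁} Z_{i₂}`-coefficient is `1`, which is not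
in `𝔪` — contradicting quasi-regularity (Matsumura Thm. 17.10). [cite: Matsumura1987, Thm. 17.10] -/
theorem cross_term_not_mem_pow_three [CharP R 2] (i₁ i₂ : Fin d) (h12 : i₁ ≠ i₂)
    (L : Finset (Fin d)) (hL₁ : i₁ ∉ L) (hL₂ : i₂ ∉ L)
    (c : R) (hc : c ∈ maximalIdeal R) (a : Fin d → R) (ha : ∀ l ∈ L, a l ∈ maximalIdeal R) :
    c ^ 2 + z i₁ * z i₂ + ∑ l ∈ L, z l * a l ∉ maximalIdeal R ^ 3 := by
  classical
  intro hmem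
  -- coordinates of `c` and of the `a l` in the generators `z` of `𝔪`
  rw [← hz] at hc
  obtain ⟨γ, hγ⟩ := Ideal.mem_span_range_iff_exists_fun.mp hc
  have ha' : ∀ l ∈ L, ∃ α : Fin d → R, ∑ j, α j * z j = a l := fun l hl =>
    Ideal.mem_span_range_iff_exists_fun.mp (hz ▸ ha l hl : a l ∈ Ideal.span (Set.range z))
  choose! α hα using ha'
  -- the degree-2 form
  let m12 : Fin d →₀ ℕ := Finsupp.single i₁ 1 + Finsupp.single i₂ 1
  set G : MvPolynomial (Fin d) R :=
    (∑ j, monomial (Finsupp.single j 2) (γ j ^ 2)) + monomial m12 1 +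
      ∑ l ∈ L, ∑ j, monomial (Finsupp.single l 1 + Finsupp.single j 1) (α l j) with hG
  have hdeg2 : ∀ j k : Fin d, (Finsupp.single j 1 + Finsupp.single k 1 : Fin d →₀ ℕ).degree = 2 := by
    intro j k
    rw [map_add, Finsupp.degree_single, Finsupp.degree_single]
  have hGhom : G.IsHomogeneous 2 := by
    refine ((IsHomogeneous.sum _ _ _ fun j _ => isHomogeneous_monomial _ ?_).add
      (isHomogeneous_monomial _ (hdeg2 i₁ i₂))).add
      (IsHomogeneous.sum _ _ _ fun l _ => IsHomogeneous.sum _ _ _ fun j _ => isHomogeneous_monomial _ (hdeg2 l j))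
    rw [Finsupp.degree_single]
  -- its value
  have h2 : (2 : R) = 0 := by
    have := CharP.cast_eq_zero R 2
    simpa using this
  have hGeval : eval z G = c ^ 2 + z i₁ * z i₂ + ∑ l ∈ L, z l * a l := by
    have e1 : eval z (∑ j, monomial (Finsupp.single j 2) (γ j ^ 2)) = c ^ 2 := by
      rw [map_sum, ← hγ, sum_pow_char 2]
      refine Finset.sum_congr rfl fun j _ => ?_
      rw [eval_monomial, Finsupp.prod_single_index (by simp), mul_pow]
    have e2 : eval z (monomial m12 (1 : R)) = z i₁ * z i₂ := by
      rw [eval_monomial, one_mul, Finsupp.prod_add_index' (by simp) (by simp [pow_add]),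
        Finsupp.prod_single_index (by simp), Finsupp.prod_single_index (by simp), pow_one, pow_one]
    have e3 : eval z (∑ l ∈ L, ∑ j, monomial (Finsupp.single l 1 + Finsupp.single j 1) (α l j)) =
        ∑ l ∈ L, z l * a l := by
      rw [map_sum]
      refine Finset.sum_congr rfl fun l hl => ?_
      rw [map_sum, ← hα l hl, Finset.mul_sum]
      refine Finset.sum_congr rfl fun j _ => ?_
      rw [eval_monomial, Finsupp.prod_add_index' (by simp) (by simp [pow_add]),
        Finsupp.prod_single_index (by simp), Finsupp.prod_single_index (by simp), pow_one, pow_one]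
      ring
    rw [hG, map_add, map_add, e1, e2, e3]
  -- quasi-regularity: the `Z_{i₁} Z_{i₂}` coefficient lies in `𝔪`
  have hcoeff := coeff_mem_maximalIdeal_of_eval_mem_pow hd z hz hGhom (by rw [hGeval]; exact hmem) m12
  -- but it is `1`
  have hm12 : ∀ j : Fin d, (Finsupp.single j 2 : Fin d →₀ ℕ) ≠ m12 := by
    intro j heq
    have h1 := congrArg (fun f : Fin d →₀ ℕ => f i₁) heq
    have hi21 : i₂ ≠ i₁ := fun h => h12 h.symm
    by_cases hj : j = i₁
    · subst hj
      simp [m12, hi21] at h1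
    · simp [m12, hi21, hj] at h1
  have hlj : ∀ l ∈ L, ∀ j : Fin d, (Finsupp.single l 1 + Finsupp.single j 1 : Fin d →₀ ℕ) ≠ m12 := by
    intro l hl j heq
    have h1 := congrArg (fun f : Fin d →₀ ℕ => f l) heq
    have hl1 : i₁ ≠ l := fun h => hL₁ (h ▸ hl)
    have hl2 : i₂ ≠ l := fun h => hL₂ (h ▸ hl)
    simp [m12, Finsupp.single_apply, hl1, hl2] at h1
  have hone : G.coeff m12 = 1 := by
    have s1 : ∑ j, coeff m12 (monomial (Finsupp.single j 2) (γ j ^ 2)) = 0 :=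
      Finset.sum_eq_zero fun j _ => by rw [coeff_monomial, if_neg (hm12 j)]
    have s3 : ∑ l ∈ L, coeff m12 (∑ j, monomial (Finsupp.single l 1 + Finsupp.single j 1) (α l j)) = 0 :=
      Finset.sum_eq_zero fun l hl => by
        rw [coeff_sum]
        exact Finset.sum_eq_zero fun j _ => by rw [coeff_monomial, if_neg (hlj l hl j)]
    rw [hG, coeff_add, coeff_add, coeff_sum, coeff_sum, coeff_monomial, if_pos rfl, s1, s3]
    ring
  rw [hone] at hcoeff
  exact (maximalIdeal.isMaximal R).ne_top (Ideal.eq_top_of_isUnit_mem _ hcoeff isUnit_one)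

end Detector

/-! ## §3 Two relations modulo a subspace are proportional -/

section LinearAlgebra

variable {F : Type u} {V : Type u} [Field F] [AddCommGroup V] [Module F V] [FiniteDimensional F V]

/-- **Relations modulo a subspace are proportional.** Let `w : Fin h → V` and a subspace `U` with
`span (range w) ⊔ U = ⊤` and `finrank V + 1 = h + finrank U` (one relation too many). If `Σ c j • w j ∈ U` with
`c ≠ 0`, then every `e` with `Σ e j • w j ∈ U` is a multiple of `c`. (Rank–nullity for `F^h → V ⧸ U`.) [folklore] -/
theorem smul_of_two_relations_mod_span {h : ℕ} (w : Fin h → V) (U : Submodule F V)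
    (hspan : Submodule.span F (Set.range w) ⊔ U = ⊤) (hdim : finrank F V + 1 = h + finrank F U)
    (c : Fin h → F) (hc : c ≠ 0) (hcU : ∑ j, c j • w j ∈ U)
    (e : Fin h → F) (heU : ∑ j, e j • w j ∈ U) : ∃ t : F, ∀ j, e j = t * c j := by
  classical
  -- the map `F^h → V ⧸ U`
  let L : (Fin h → F) →ₗ[F] (V ⧸ U) := U.mkQ.comp (Fintype.linearCombination F w)
  have hL : ∀ v : Fin h → F, L v = U.mkQ (∑ j, v j • w j) := by
    intro v
    simp [L, Fintype.linearCombination_apply]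
  have hrange : LinearMap.range L = ⊤ := by
    rw [LinearMap.range_comp, Fintype.range_linearCombination, Submodule.map_mkQ_eq_top, sup_comm, hspan]
  have hker : finrank F (LinearMap.ker L) = 1 := by
    have h1 := LinearMap.finrank_range_add_finrank_ker L
    rw [hrange, finrank_top, Module.finrank_fintype_fun_eq_card, Fintype.card_fin] at h1
    have h2 := Submodule.finrank_quotient_add_finrank U
    omega
  have hmc : c ∈ LinearMap.ker L := by
    rw [LinearMap.mem_ker, hL, Submodule.mkQ_apply, Submodule.Quotient.mk_eq_zero]; exact hcU
  have hme : e ∈ LinearMap.ker L := by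
    rw [LinearMap.mem_ker, hL, Submodule.mkQ_apply, Submodule.Quotient.mk_eq_zero]; exact heU
  have hne : (⟨c, hmc⟩ : LinearMap.ker L) ≠ 0 := fun h0 => hc (congrArg Subtype.val h0)
  obtain ⟨t, ht⟩ := (finrank_eq_one_iff_of_nonzero' _ hne).mp hker ⟨e, hme⟩
  refine ⟨t, fun j => ?_⟩
  have := congrArg (fun v : LinearMap.ker L => (v : Fin h → F) j) ht
  simpa [mul_comm] using this.symm

end LinearAlgebra

/-! ## §4 Extending independent cotangent classes to a regular system of parameters -/

section Rsop

variable {R : Type u} [CommRing R] [IsRegularLocalRing R]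

/-- **Independent cotangent classes are the first members of a regular system of parameters**: if `w : Fin r → 𝔪`
have linearly independent classes in `𝔪/𝔪²`, there is a minimal basis `x : Fin (r + e) → R` of `𝔪` with
`(𝔪).spanFinrank = r + e` whose first `r` members are the `w i`. [cite: Matsumura1987, Thm. 14.2] -/
theorem exists_rsop_extending {r : ℕ} (w : Fin r → R) (hw : ∀ i, w i ∈ maximalIdeal R)
    (hli : LinearIndependent (ResidueField R) fun i => (maximalIdeal R).toCotangent ⟨w i, hw i⟩) :
    ∃ (e : ℕ) (x : Fin (r + e) → R), (maximalIdeal R).spanFinrank = r + e ∧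
      Ideal.span (Set.range x) = maximalIdeal R ∧ ∀ i, x (Fin.castAdd e i) = w i := by
  have hind := (linearIndependent_toCotangent_iff_forall_mem w hw).mp hli
  obtain ⟨e, y, hdim, hspan⟩ := exists_extend_to_rsop w hw hind
  have hpart : IsRsopPart w := ⟨inferInstance, e, y, hdim, hspan⟩
  exact hpart.exists_rsop

end Rsop

end Summit.ResolutionOfSingularities.ResolutionOfSingularities.Theorems.SwitchingDichotomy.LowOrderDetector

end
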